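/-
K2-LIT rung 3 ∕ (B) of ★ p855563 (prover seat hodgecm-mathlib-K2E1-p05, gen 2): THE SIEGEL RADICAL OF `U(Φ₂)` HAS COCOMPACT RATIONAL POINTS — hypothesis (B) of
★ `K2E1GlobaliseSupercuspidalU2Poincare.globaliseSupercuspidal_of_poincare` at `𝔓 := cmParabolicData L 2`, discharged.
-/
import Summits.HodgeConjecture.HodgeConjecture.Theorems.K2E1PoincareSeriesCuspidalGlueU2     -- ★ p855468 §2 `finiteCovolume_of_isCompact` (this seat) → ★ p855192 (rung 1, countability of `G(K)`)
import Summits.HodgeConjecture.HodgeConjecture.Theorems.K2E1CuspidalSpectrumUnitaryDefs      -- ★ p855325 `cmUnipotentRadical`, `cmParabolicData`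
import Literature.NumberTheory.Automorphic.UnitaryGroupLineUnipotentTwo                      -- ★ `N(𝔸_F) ≅ 𝔸_E⁻` at `N = 2`, Tate's compact fundamental set for `E⁻ ⊂ 𝔸_E⁻` transported
import Literature.NumberTheory.Automorphic.LocalUnitaryGroupCongr                            -- ★ `antidiagOne_eq_over` (`Φ₂ = (StdForm.antidiagonal 2).over L`)
import HarnessLib

/-!
# The Siegel radical of `U(Φ₂)`: `N(L⁺)` is cocompact in `N(𝔸_{L⁺})`, so (B) of ★ p855563 holds

For the quasi-split unitary group `U(Φ₂)` in two variables attached to a CM extension `L/L⁺` (`Φ₂` antidiagonal) the unipotent radical of the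
(unique, Siegel = Borel) proper standard parabolic is the line `N = {n(b) = [[1,b],[0,1]] : b + b̄ = 0} ≅ 𝔸_L⁻`, with rational points `L⁻`.  Tate's
theorem `𝔸_L = L + D` (`D` relatively compact) gives `𝔸_L⁻ = L⁻ + (closure D)⁻` — in the tree: ★ `UnitaryGroupTraceZeroLattice` and, transported to
`N(𝔸_{L⁺}) = adelicUnipotent L⁺ L c 2`, ★ `UnitaryGroupLineUnipotentTwo.existsUnique_smul_mem_image_traceZeroFundamentalDomain_two` /
`exists_isCompact_image_traceZeroFundamentalDomain_subset_two`.  This file carries that compact fundamental SET over to the route's spelling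
`cmUnipotentRadical L 2 1 ≤ U(Φ₂)(𝔸_{L⁺}) = (cmDatum L 2 Φ₂).Adelic` (★ p855325; the two spellings differ by `Φ₂` vs `(StdForm.antidiagonal 2).over L`,
★ `antidiagOne_eq_over`, and by `1 + 𝔫_1` vs upper unitriangular, §1) and concludes, with ★ p855468 §2 `finiteCovolume_of_isCompact`, hypothesis
**(B)** of ★ p855563 `globaliseSupercuspidal_of_poincare` at `𝔓 := cmParabolicData L 2`: every fundamental domain of `N(L⁺)` in `(N(𝔸_{L⁺}), ν)`,
`ν` a Haar measure, has finite measure (§3).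

## Contents
* §1 `upperUnitriangular_eq_standardUnipotentRadical_two`: in `GL₂(R)` the upper unitriangular matrices ARE `1 + 𝔫_1(R)`.
* §2 `exists_isCompact_rational_smul_mem_of_eq`, `exists_isCompact_rational_smul_mem_siegel`: a compact `C ⊆ N(𝔸)` with `N(K) • C = N(𝔸)`, for any
  subgroup EQUAL to `adelicUnipotent F E c 2` and for any form EQUAL to `(StdForm.antidiagonal 2).over L` (transport by `subst`).
* §3 `countable_rational_cmParabolicData`, **`finiteCovolume_cmParabolicData_two`** = (B) (binder for binder).
-/

set_option autoImplicit false

set_option linter.dupNamespace false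

open MeasureTheory Filter Topology NumberField IsDedekindDomain
open scoped ENNReal Pointwise
open Literature.NumberTheory.Automorphic Literature.NumberTheory.Automorphic.UnitaryGroup
open Literature.NumberTheory.Automorphic.AdelicGroupData.ParabolicUnipotentData (coe_mem_quotientSubgroup_of_mem_rational)
open Summit.HodgeConjecture.HodgeConjecture.Cruxes.H413.K2E1PoincareSeriesCompactSupport (countable_quotientSubgroup_of_center'_eq_bot)
open Summit.HodgeConjecture.HodgeConjecture.Cruxes.H413.K2E1PoincareSeriesCuspidalGlueU2 (finiteCovolume_of_isCompact)
open Summit.HodgeConjecture.HodgeConjecture.Cruxes.H413.K2E1CuspidalSpectrumUnitary (cmUnipotentRadical cmParabolicData)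

namespace Summit.HodgeConjecture.HodgeConjecture.Cruxes.H413.K2E1SiegelRadicalCocompactU2

/-! ## §1 Upper unitriangular `2 × 2` matrices are `1 + 𝔫_1` -/

section Unitriangular

/-- **In `GL₂(R)` the upper unitriangular subgroup equals the standard unipotent radical `1 + 𝔫_1(R)`** (`𝔫_1` = matrices supported on the entry `(0,1)`):
both are `{[[1,b],[0,1]]}`. [cite: BorelJacquet1979, §4.4] -/
theorem upperUnitriangular_eq_standardUnipotentRadical_two (R : Type*) [CommRing R] :
    upperUnitriangular (Fin 2) R = standardUnipotentRadical 2 1 R := by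
  ext g
  rw [mem_upperUnitriangular_iff]
  constructor
  · rintro ⟨htri, hdiag⟩
    have hmem : (g : Matrix (Fin 2) (Fin 2) R) - 1 ∈ blockNilpotent 2 1 R := by
      intro i j hij
      by_contra hcon
      apply hij
      rw [Matrix.sub_apply]
      rcases Nat.lt_or_ge j.val i.val with hlt | hge
      · rw [htri (Fin.lt_def.2 hlt), Matrix.one_apply_ne (Fin.lt_def.2 hlt).ne', sub_zero]
      · have hi2 := i.isLt
        have hj2 := j.isLt
        have hij' : i = j := Fin.ext (by omega)
        subst hij'
        rw [hdiag, Matrix.one_apply_eq, sub_self]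
    refine ⟨Multiplicative.ofAdd ⟨_, hmem⟩, ?_⟩
    ext i j
    rw [coe_unipotentOfBlock]
    change ((1 : Matrix (Fin 2) (Fin 2) R) + ((g : Matrix (Fin 2) (Fin 2) R) - 1)) i j = _
    rw [add_sub_cancel]
  · rintro ⟨X, rfl⟩
    have hX : ∀ i j, (X.toAdd : Matrix (Fin 2) (Fin 2) R) i j ≠ 0 → (i : ℕ) < 1 ∧ 1 ≤ (j : ℕ) := X.toAdd.2
    refine ⟨fun i j hlt => ?_, fun i => ?_⟩
    · have hlt' : j.val < i.val := Fin.lt_def.1 hlt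
      have hzero : (X.toAdd : Matrix (Fin 2) (Fin 2) R) i j = 0 := by
        by_contra h
        have := hX i j h
        omega
      rw [coe_unipotentOfBlock, Matrix.add_apply, hzero, add_zero]
      exact Matrix.one_apply_ne (Fin.ne_of_gt (Fin.lt_def.2 hlt'))
    · have hzero : (X.toAdd : Matrix (Fin 2) (Fin 2) R) i i = 0 := by
        by_contra h
        have := hX i i h
        omega
      rw [coe_unipotentOfBlock, Matrix.add_apply, hzero, Matrix.one_apply_eq, add_zero]

end Unitriangular

/-! ## §2 A compact fundamental set for `N(K)` in `N(𝔸)` -/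

section Quasisplit

variable {F E : Type} [Field F] [NumberField F] [Field E] [NumberField E] [Algebra F E] {c : E ≃ₐ[F] E}

/-- **`N(F) • C = N(𝔸_F)` for a compact `C`, for the line radical of `U(J₂)`** (`c² = 1`): `C = n((closure D_E)⁻)`, Tate's compact fundamental set for
`E⁻ ⊂ 𝔸_E⁻` pushed through the chart `b ↦ n(b)` (★ `existsUnique_smul_mem_image_traceZeroFundamentalDomain_two`, ★
`exists_isCompact_image_traceZeroFundamentalDomain_subset_two`); stated for every subgroup `Nsub` EQUAL to `adelicUnipotent F E c 2`, with its rational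
points `G(F) ∩ Nsub`. [cite: CasselsFrohlichANT1967, Ch. XV Thm. 4.1.3] [cite: BorelJacquet1979, §4.4] -/
theorem exists_isCompact_rational_smul_mem_of_eq (hc : c * c = 1) {Nsub : Subgroup (quasiSplit F E c 2).Adelic} (hN : Nsub = adelicUnipotent F E c 2) :
    ∃ C : Set ↥Nsub, IsCompact C ∧ ∀ u : ↥Nsub, ∃ l : ↥(((quasiSplit F E c 2).arithmeticSubgroup).comap Nsub.subtype), l • u ∈ C := by
  subst hN
  obtain ⟨C, hC, hsub⟩ := exists_isCompact_image_traceZeroFundamentalDomain_subset_two (F := F) (E := E) (c := c) (by decide) (by decide) hc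
  refine ⟨C, hC, fun u => ?_⟩
  obtain ⟨γ, hγ, -⟩ := existsUnique_smul_mem_image_traceZeroFundamentalDomain_two (F := F) (E := E) (c := c) (by decide) (by decide) hc u
  exact ⟨γ, hsub hγ⟩

end Quasisplit

section CM

variable (L : Type) [Field L] [NumberField L] [IsCMField L]

/-- **`N(L⁺) • C = N(𝔸_{L⁺})` for a compact `C`, for the Siegel radical `U(J) ∩ (1 + 𝔫_1)` of `U(J)`, `J` ANY matrix equal to `(StdForm.antidiagonal 2).over L`**
(in particular the route's `Φ₂`, ★ `antidiagOne_eq_over`): §2 for `Nsub := (1 + 𝔫_1(𝔸_L)).comap adelicVal = adelicUnipotent` (§1), transported along `J = J'` by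
substitution. [cite: CasselsFrohlichANT1967, Ch. XV Thm. 4.1.3] [cite: BorelJacquet1979, §4.4] -/
theorem exists_isCompact_rational_smul_mem_siegel {J : Matrix (Fin 2) (Fin 2) L} (hJ : (StdForm.antidiagonal 2).over L = J) :
    ∃ C : Set ↥((standardUnipotentRadical 2 1 (AdeleRing (𝓞 L) L)).comap
        (adelicVal (↥(maximalRealSubfield L)) L (IsCMField.complexConj L) 2 J)), IsCompact C ∧
      ∀ u, ∃ l : ↥(((adelicGroupData (↥(maximalRealSubfield L)) L (IsCMField.complexConj L) 2 J).arithmeticSubgroup).comap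
        ((standardUnipotentRadical 2 1 (AdeleRing (𝓞 L) L)).comap (adelicVal (↥(maximalRealSubfield L)) L (IsCMField.complexConj L) 2 J)).subtype), l • u ∈ C := by
  subst hJ
  -- `c² = 1` (★ `IsCMField.orderOf_complexConj`)
  exact exists_isCompact_rational_smul_mem_of_eq (by rw [← pow_two, ← IsCMField.orderOf_complexConj L, pow_orderOf_eq_one])
    (congrArg (Subgroup.comap (adelicVal (↥(maximalRealSubfield L)) L (IsCMField.complexConj L) 2 ((StdForm.antidiagonal 2).over L)))
      (upperUnitriangular_eq_standardUnipotentRadical_two (AdeleRing (𝓞 L) L)).symm)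

/-! ## §3 (B) of ★ p855563 at `𝔓 := cmParabolicData L 2` -/

/-- `N_i(L⁺)` is countable (it injects into `U(Φ₂)(L⁺)`, countable by ★ rung 1). [cite: BorelJacquet1979, §4.4] -/
theorem countable_rational_cmParabolicData (i : (cmParabolicData L 2).ι) : Countable ((cmParabolicData L 2).rational i) := by
  haveI := countable_quotientSubgroup_of_center'_eq_bot (cmDatum L 2 (Matrix.of fun i j : Fin 2 => if i.val + j.val + 1 = 2 then (1 : L) else 0)) rfl
    (cmDatum_isDiscreteRational L 2 _)
  exact Function.Injective.countable
    (f := fun l : (cmParabolicData L 2).rational i =>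
      (⟨((l : (cmParabolicData L 2).radical i) : (cmDatum L 2 (Matrix.of fun i j : Fin 2 => if i.val + j.val + 1 = 2 then (1 : L) else 0)).Adelic),
        coe_mem_quotientSubgroup_of_mem_rational (cmParabolicData L 2) l.2⟩ :
        (cmDatum L 2 (Matrix.of fun i j : Fin 2 => if i.val + j.val + 1 = 2 then (1 : L) else 0)).quotientSubgroup))
    fun a b h => Subtype.ext (Subtype.ext (congrArg Subtype.val h :))

/-- **(B) OF ★ p855563 FOR `U(Φ₂)`: FUNDAMENTAL DOMAINS OF `N(L⁺)` IN `N(𝔸_{L⁺})` HAVE FINITE HAAR MEASURE.**  For the route's parabolic data `cmParabolicData L 2` (one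
index, the Siegel radical `cmUnipotentRadical L 2 1`), every Haar measure `ν` on `↥N(𝔸_{L⁺})` and every fundamental domain `𝓕` of the left action of `N(L⁺)`:
`ν 𝓕 < ∞` — by ★ p855468 §2 `finiteCovolume_of_isCompact` and the compact fundamental set of §2.  This is hypothesis `hB` of ★
`K2E1GlobaliseSupercuspidalU2Poincare.globaliseSupercuspidal_of_poincare` at `𝔓 := cmParabolicData L 2`, token for token.
[cite: CasselsFrohlichANT1967, Ch. XV Thm. 4.1.3] [cite: BorelJacquet1979, §4.4] [cite: GelfandGraevPiatetskiShapiro1969, Ch. 1 §4] -/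
theorem finiteCovolume_cmParabolicData_two (i : (cmParabolicData L 2).ι) [MeasurableSpace ((cmParabolicData L 2).radical i)]
    [BorelSpace ((cmParabolicData L 2).radical i)] (νN : Measure ((cmParabolicData L 2).radical i)) [νN.IsHaarMeasure]
    (𝓕 : Set ((cmParabolicData L 2).radical i)) (h𝓕 : IsFundamentalDomain ((cmParabolicData L 2).rational i) 𝓕 νN) : νN 𝓕 < ∞ := by
  haveI := countable_rational_cmParabolicData L i
  obtain ⟨k, hk⟩ := i
  obtain rfl : k = 1 := by omega
  obtain ⟨C, hC, hcov⟩ :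
      ∃ C : Set ↥((cmParabolicData L 2).radical ⟨1, hk⟩), IsCompact C ∧
        ∀ u : ↥((cmParabolicData L 2).radical ⟨1, hk⟩), ∃ l : (cmParabolicData L 2).rational ⟨1, hk⟩, l • u ∈ C :=
    exists_isCompact_rational_smul_mem_siegel L (antidiagOne_eq_over (L := L) (N := 2)).symm
  exact finiteCovolume_of_isCompact (cmParabolicData L 2) ⟨1, hk⟩ C hC hcov νN 𝓕 h𝓕

end CM

end Summit.HodgeConjecture.HodgeConjecture.Cruxes.H413.K2E1SiegelRadicalCocompactU2
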